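import Literature.MathematicalPhysics.StatisticalMechanics.StickyDiscFluctuations
import Literature.Geometry.DiscreteGeometry.TriangularLatticeAnimals
import Mathlib.Topology.MetricSpace.HausdorffDistance
import Mathlib.Analysis.SpecialFunctions.Pow.Real
import HarnessLib

/-!
# Davoli–Piovano–Stefanelli 2017: the sharp `N^{3/4}` law for the minimizers of the
# edge-isoperimetric problem on the triangular lattice

Topic `Literature/MathematicalPhysics/StatisticalMechanics`; cross-ladder literature-typing layer
(D-0088 (4)), cell `crystal3d-full`, seat `littype-FC1-2` (gen 5).  Third file of the two-dimensional
origin of row (4)'s topic, after `StickyDiscWulffShape.lean` (Au Yeung–Friesecke–Schmidt 2012) and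
`StickyDiscFluctuations.lean` (Schmidt 2013): the SHARP constant of the `N^{3/4}` law and the
isoperimetric characterization of the minimizers of the edge-isoperimetric problem (EIP) on the
triangular lattice — the theorem that Cicalese–Leonardi 2020 §3.3 (`CicaleseLeonardi2020_triangular`,
`LatticeMaximalFluctuations.lean`) re-derives without the sharp constant.  Sibling of the tree's SOLVED
square and cubic EIPs (`SquareLatticeEdgeIsoperimetry.lean`, `CubicLatticeEdgeIsoperimetry.lean`, seat
`littype-FC1-1`).

## Source, as printed

E. Davoli, P. Piovano, U. Stefanelli, *Sharp `N^{3/4}` law for the minimizers of the edge-isoperimetric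
problem on the triangular lattice*, J. Nonlinear Sci. **27** (2017) 627–660 [DavoliPiovanoStefanelli2017]
— read on the open-access journal PDF (`paper:url-608894250b79`, CC-BY; journal page numbers).

* p. 628: `𝓛_t := {m t₁ + n t₂ : m, n ∈ ℤ}`, `t₁ = (1,0)`, `t₂ = (½, √3/2)`; `𝒞_n` = sets of `n` distinct
  elements of `𝓛_t`; (1) the edge perimeter `|Θ(C_n)|`, `Θ(C_n) = {(x,y) : x ∈ C_n, y ∈ 𝓛_t ∖ C_n,
  |x − y| = 1}`; (2) `θ_n := min_{C_n ∈ 𝒞_n} |Θ(C_n)|`.  P. 630: (10) `|Θ(C_n)| = Σᵢ(6 − b(xᵢ)) =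
  6n + 2E(C_n)`; (11)–(12) `θ_n = 2⌈√(12n − 3)⌉` (Heitmann–Radin); "we say that a configuration
  `C_n` is connected if … `y₁ = xᵢ`, `y_K = xⱼ`, and either `(y_k, y_{k+1})` or `(y_{k+1}, y_k)` is in
  `B(C_n)`"; "minimizers of the EIP need to be connected".
* P. 635: (25) `A(C_n) := |T(C_n)|`, `T(C_n)` the triples of elements of `C_n` at mutual distance `1`
  (unit triangles); (26) `P(C_n) := 𝓗¹(∂F(C_n)) + 2𝓗¹(G(C_n))`, `F` the closure of the union of the
  triangles, `G` the union of the bonds not in `F`; p. 636: (28) `E(C_n) = −(3/2)A(C_n) − ½P(C_n)`,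
  **(29) `|Θ(C_n)| = 6n − 3A(C_n) − P(C_n)`**.
* **Theorem 1.1** (Isoperimetric characterization, p. 631). "Every connected configuration `C_n ∈ 𝒞_n`
  satisfies `√(A(C_n)) ≤ k_n P(C_n)` (13), where `k_n := √(−2θ_n + 8n + 4)/(θ_n − 6)` (14).
  Moreover, connected minimizers `M_n ∈ 𝒞_n` of the EIP correspond to those configurations for which
  (13) holds with the equality.  Finally, connected minimizers attain the maximal area
  `a_n := −θ_n/2 + 2n + 1` and the minimal perimeter `p_n := θ_n/2 − 3`."  (P. 641, Step 1: "the
  maximal area and the minimal perimeter among connected configurations are realized by `A(D_n)` and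
  `P(D_n)`".)
* P. 641, (54)–(56): `𝓗^{M_n}_s := {H_s ⊂ 𝓛_t : H_s = D_{1+3s+3s²} + q for some q ∈ 𝓛_t and H_s ⊂ M_n}`,
  `r_{M_n} := max{s ∈ ℕ ∪ {0} : 𝓗^{M_n}_s ≠ ∅}` (55), `H_{r_{M_n}}` "the maximal hexagon associated to
  `M_n`", `#(M_n ∩ H_{r_{M_n}}) = 1 + 3r + 3r²` (56); p. 631: "each configuration `D_{1+3s+3s²}` can be
  seen as the intersection of `𝓛_t` and a regular hexagon with side `s`".
* **Proposition 3.7** (p. 651). "Let `M_n` be a minimizer of (2) with maximal radius `r_{M_n}`.  Then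
  `r_{M_n} ≥ ⌈α_n⌉/6 − 2 − (1/6)√(⌈α_n⌉² − (α_n)² + 75)` (69) with `α_n := √(12n − 3)` (70)."
* **Theorem 1.2** (Convergence to the Wulff shape, p. 632). "For every sequence of minimizers `M_n` in
  `𝓛_t`, there exists a sequence of suitable translations `M'_n` such that `μ_{M'_n} ⇀* (2/√3) χ_W`
  weakly* in the sense of measures, where `χ_W` is the characteristic function of the regular hexagon
  `W` defined as the convex hull of the vectors `{±(1/√3)t₁, ±(1/√3)t₂, ±(1/√3)(t₂ − t₁)}`.  Furthermore
  … `|M_n ∖ H_{r_{M_n}}| ≤ K_t n^{3/4} + o(n^{3/4})` (15), `‖μ_{M_n} − μ_{H_{r_{M_n}}}‖ ≤ K_t n^{−1/4} +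
  o(n^{−1/4})` (16), `‖μ_{M'_n} − μ_{H_{r_{M_n}}}‖_F ≤ K_t n^{−1/4} + o(n^{−1/4})` (17), and
  `‖μ_{M'_n} − (2/√3)χ_W‖_F ≤ 2K_t n^{−1/4} + o(n^{−1/4})` (18), where … `K_t := 2/3^{1/4}` (19)."
  Here `μ_{C_n} := n⁻¹ Σᵢ δ_{xᵢ/√n}` (p. 631) and (72) `‖μ‖_F := sup{∫ φ dμ : φ Lipschitz with
  ‖φ‖_{W^{1,∞}} ≤ 1}`.
* **Corollary 1.3** (Hausdorff distance, p. 633). "For any minimizer `M_n` and its associated maximal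
  hexagon `H_{r_{M_n}}` there holds `d_H(M_n, H_{r_{M_n}}) ≤ 2·3^{1/4} n^{1/4} + O(1)` (20)."
* **Theorem 1.4** (Sharpness of the estimates, p. 634). "A sequence of minimizers `M_{n_i}` satisfying
  (15)–(17) with equalities can be explicitly constructed for `n_i := 2 + 3i + 3i²` with `i ∈ ℕ`."

## Rendering

* Configurations are `Finset`s in `Theil2006.Plane` contained in `𝓛_t = Theil2006.triangularLattice`
  (`t₁ = triVec₁`, `t₂ = triVec₂` verbatim); the EIP minimizers (2) are the tree's
  `CicaleseLeonardi2020.IsAlmostMinimal triangularLattice triangularExcess C 0` (`IsTriMinimizer`; the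
  excess `½Σ val` of `LatticeMaximalFluctuations.lean` is `½|Θ|`, `edgeBoundaryCard_eq`), and
  "connected" is the tree's `CicaleseLeonardi2020.IsBondConnected`.
* `P(C_n)` is typed through the identity **(29) `P = 6n − 3A − |Θ|`**, which the source derives from
  (25)–(28) for every configuration (p. 635–636), so that on `𝒞_n` it IS the quantity (26); the
  geometric form `𝓗¹(∂F) + 2𝓗¹(G)` is not restated.
* The maximal hexagon: `H_s = D_{1+3s+3s²} + q` with `D_{1+3s+3s²} = 𝓛_t ∩ (hexagon of side s)` is
  `triPoint '' HarborthSpiral.hexagon s + q` (labels `|m|, |n|, |m+n| ≤ s`; cardinality `3s(s+1)+1`,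
  `Schmidt2013.card_hexagon`); `r_M = maxHexRadius M` (55); `|M_n ∖ H_{r_{M_n}}| = n − (1 + 3r + 3r²)`
  (56) is written as `n − #hexagon(r_{M_n})`.
* `o(·)`-statements "for every sequence of minimizers" are typed literally along sequences
  `M : ℕ → Finset`, `M_n` a minimizer with `n` points: "`x_n ≤ K n^{3/4} + o(n^{3/4})`" ⟺ "for every
  `δ > 0`, eventually `x_n ≤ (K + δ) n^{3/4}`"; "(15) with equality" (Theorem 1.4) ⟺
  `x_{n_i}/n_i^{3/4} → K_t`; Corollary 1.3's `O(1)` is a constant `C`, and "its associated maximal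
  hexagon" (a CHOICE at (55)) is rendered "for some hexagon `H_{r_{M_n}} ⊆ M_n` of maximal radius".
* Weak* convergence and the flat norm as in `StickyDiscWulffShape.lean` / `StickyDiscFluctuations.lean`
  (`C₀` test functions; `Schmidt2013.flatNorm`, i.e. `‖φ‖_∞ ≤ 1` and `Lip φ ≤ 1` — Whitney's flat norm,
  the reading of `‖φ‖_{W^{1,∞}} ≤ 1`); `W = AuYeungFrieseckeSchmidt2012.wulffHexagon` (same hexagon,
  p. 632 confirms the normalisation); `μ_{C}` of a finite SET is `setEmpiricalIntegral`
  (`= AuYeungFrieseckeSchmidt2012.empiricalIntegral` of any injective labelling,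
  `setEmpiricalIntegral_image`).
* (16)–(17) (total-variation / flat distance to `μ_{H_{r_{M_n}}}`) are not typed separately ((16) is
  (15) divided by `n`).

## Contents (namespace `Literature.MathematicalPhysics.StatisticalMechanics.DavoliPiovanoStefanelli2017`)

§1 `edgeBoundaryCard` ((1)), `IsTriMinimizer` ((2)), `theta` ((12)), `area` ((25)), `perimeter` ((29)),
`isoConstant` ((14)), `maxArea`/`minPerimeter` (`a_n`, `p_n`); PROVED `edgeBoundaryCard_eq`, and at the
centred hexagonal numbers `n = 3s² + 3s + 1`: `theta_hexagonal` (`θ_n = 12s + 6`),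
`maxArea_minPerimeter_hexagonal` (`a_n = 6s²`, `p_n = 6s`), `isoConstant_hexagonal` (`k_n = 1/√6`, `s ≥ 1`).
§2 NAMED FACT `DavoliPiovanoStefanelli2017_isoperimetric` (Theorem 1.1) — **DISCHARGED in §4**
(`DavoliPiovanoStefanelli2017_isoperimetric_holds`).
§3 `maxHexRadius` ((55)), `alpha` ((70)), `sharpConstant` (`K_t`, (19)), `setEmpiricalIntegral`;
NAMED FACTS `DavoliPiovanoStefanelli2017_maximalRadius` (Proposition 3.7),
`DavoliPiovanoStefanelli2017_wulffShape` (Theorem 1.2: weak*, (15), (18)),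
`DavoliPiovanoStefanelli2017_hausdorff` (Corollary 1.3), `DavoliPiovanoStefanelli2017_sharpness`
(Theorem 1.4); PROVED `setEmpiricalIntegral_image`, `maxHexRadius_le_card`-type bookkeeping
(`exists_hexagon_subset`: the radius-`0` hexagon, so the maximum in (55) is over a non-empty set).

§4 **Theorem 1.1 PROVED** (`DavoliPiovanoStefanelli2017_isoperimetric_holds`, gen 6): transfer
`C = triPoint(S)` to label sets (`valence = 6 − deg`, so `|Θ| = 6n − 2b`; `A(C) = triCount S` — every
triple of pairwise adjacent labels is an up or a down unit triangle; bond-connectedness and EIP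
minimality ⇔ `b = [3n − √(12n−3)]`, the on-lattice Harborth bound of `TriangularLatticeContactBound.lean`
with its spiral extremisers), then Euler's inequality `A + n ≤ b + 1` for animals and the equality
`b + 1 = A + n` for contact-maximal (row-convex) animals (`TriangularLatticeAnimals.lean`) give
Proposition 2.3 (`A ≤ a_n`, `P ≥ p_n`), (13) with `k_n = √(a_n)/p_n`, and the characterization.
NOTE ON THE PRINTED PROOF: the source derives Proposition 2.3 from the identities (34)–(37) of
Proposition 2.2, whose proof ((38)–(41)) presumes that the earlier neighbours of each added point are
consecutive around it; for a general connected configuration this fails (e.g. `{x_τ(2), x_τ(6), x_τ(7)}`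
has `|C⁰| = 2` though connected, and `A = 0 ≠ |C²| + 2|C³| = 1`), so we replace (35)–(36) by the
Euler relations above — the statement of Theorem 1.1 is unaffected.

WHAT IS NOT HERE: Proposition 2.1 (Harper's nested daisies), Propositions 3.1, 3.3, 3.5, Lemma 3.6,
the order `τ` and weights `ω`; (16)–(17); the companion honeycomb paper (Davoli–Piovano–Stefanelli 2016).
-/

noncomputable section

open MeasureTheory Set Filter Function Metric Finset
open scoped ENNReal Topology Pointwise

namespace Literature.MathematicalPhysics.StatisticalMechanics.DavoliPiovanoStefanelli2017

open CicaleseLeonardi2020 (valence triangularExcess IsAlmostMinimal IsBondConnected)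
open Theil2006 (Plane triPoint triangularLattice)
open Literature.Geometry.DiscreteGeometry.HarborthSpiral (hexagon)
open AuYeungFrieseckeSchmidt2012 (wulffHexagon empiricalIntegral)
open Schmidt2013 (flatNorm)

/-! ## §1 Edge perimeter, area, perimeter -/

/-- **The edge perimeter `|Θ(C)|` (1)**: the number of pairs `(x, y)`, `x ∈ C`, `y ∈ 𝓛_t ∖ C`,
`|x − y| = 1` — the sum over `x ∈ C` of the valences `#{y ∈ 𝓛_t ∖ C : |y − x| = 1}`.
[cite: DavoliPiovanoStefanelli2017, (1) p. 628 and (10) p. 630] -/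
def edgeBoundaryCard (C : Finset Plane) : ℕ :=
  ∑ x ∈ C, valence triangularLattice C x

/-- `|Θ(C)| = 2 · (½ Σ val)`: the edge perimeter is twice Cicalese–Leonardi's triangular excess energy.
[cite: DavoliPiovanoStefanelli2017, (10) p. 630] -/
theorem edgeBoundaryCard_eq (C : Finset Plane) :
    (edgeBoundaryCard C : ℝ) = 2 * triangularExcess C := by
  unfold edgeBoundaryCard triangularExcess
  push_cast
  ring

/-- **Minimizers of the EIP (2)**: `C ⊂ 𝓛_t` with `|Θ(C)| ≤ |Θ(C')|` for every `C' ⊂ 𝓛_t` with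
`#C' = #C` — the tree's `IsAlmostMinimal 𝓛_t (½Σ val) C 0`. [cite: DavoliPiovanoStefanelli2017, (2) p. 628] -/
def IsTriMinimizer (C : Finset Plane) : Prop :=
  IsAlmostMinimal triangularLattice triangularExcess C 0

/-- **`θ_n = 2⌈√(12n − 3)⌉` (12)**, the minimal edge perimeter of `n` points (Heitmann–Radin, (11)).
[cite: DavoliPiovanoStefanelli2017, (11)–(12) p. 630] -/
def theta (n : ℕ) : ℤ :=
  2 * ⌈Real.sqrt (12 * (n : ℝ) - 3)⌉

/-- **The area `A(C) = |T(C)|` (25)**: the number of unit triangles (triples of points of `C` at mutual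
distance `1`). [cite: DavoliPiovanoStefanelli2017, (25) p. 635] -/
def area (C : Finset Plane) : ℕ :=
  ((C.powersetCard 3).filter fun t => ∀ x ∈ t, ∀ y ∈ t, x ≠ y → dist x y = 1).card

/-- **The perimeter `P(C)`**, typed through the identity (29) `P(C) = 6n − 3A(C) − |Θ(C)|`, `n = #C`
(equal, for every configuration, to (26) `𝓗¹(∂F(C)) + 2𝓗¹(G(C))`, p. 635–636).
[cite: DavoliPiovanoStefanelli2017, (26) p. 635 and (29) p. 636] -/
def perimeter (C : Finset Plane) : ℝ :=
  6 * (C.card : ℝ) - 3 * (area C : ℝ) - (edgeBoundaryCard C : ℝ)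

/-- **The isoperimetric constant `k_n := √(−2θ_n + 8n + 4)/(θ_n − 6)` (14)** (`≤ 1/√6`, with equality
iff `n = 1 + 3s + 3s²`). [cite: DavoliPiovanoStefanelli2017, (14) p. 631] -/
def isoConstant (n : ℕ) : ℝ :=
  Real.sqrt (-2 * (theta n : ℝ) + 8 * n + 4) / ((theta n : ℝ) - 6)

/-- **The maximal area `a_n := −θ_n/2 + 2n + 1`** of connected `n`-point configurations.
[cite: DavoliPiovanoStefanelli2017, Theorem 1.1 p. 631] -/
def maxArea (n : ℕ) : ℝ :=
  -(theta n : ℝ) / 2 + 2 * n + 1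

/-- **The minimal perimeter `p_n := θ_n/2 − 3`** of connected `n`-point configurations.
[cite: DavoliPiovanoStefanelli2017, Theorem 1.1 p. 631] -/
def minPerimeter (n : ℕ) : ℝ :=
  (theta n : ℝ) / 2 - 3

/-- At the centred hexagonal numbers `n = 3s² + 3s + 1`, `√(12n − 3) = 6s + 3` and `θ_n = 12s + 6`
(the edge perimeter of the hexagonal daisy `D_{1+3s+3s²}`). [cite: DavoliPiovanoStefanelli2017, (12) p. 630 and p. 631 (`k_n = 1/√6` iff `n = 1 + 3s + 3s²`)] -/
theorem theta_hexagonal (s : ℕ) : theta (3 * s ^ 2 + 3 * s + 1) = 12 * s + 6 := by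
  have hs : (0 : ℝ) ≤ 6 * s + 3 := by positivity
  have hsq : (12 * ((3 * s ^ 2 + 3 * s + 1 : ℕ) : ℝ) - 3) = (6 * s + 3) ^ 2 := by
    push_cast; ring
  unfold theta
  rw [hsq, Real.sqrt_sq hs]
  have : ((6 : ℝ) * s + 3) = ((6 * s + 3 : ℤ) : ℝ) := by push_cast; ring
  rw [this, Int.ceil_intCast]
  ring

/-- At `n = 3s² + 3s + 1` the maximal area is `a_n = 6s²` (the `6s²` unit triangles of the hexagon of
side `s`) and the minimal perimeter is `p_n = 6s` (its boundary length).
[cite: DavoliPiovanoStefanelli2017, Theorem 1.1 p. 631] -/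
theorem maxArea_minPerimeter_hexagonal (s : ℕ) :
    maxArea (3 * s ^ 2 + 3 * s + 1) = 6 * (s : ℝ) ^ 2 ∧ minPerimeter (3 * s ^ 2 + 3 * s + 1) = 6 * s := by
  unfold maxArea minPerimeter
  rw [theta_hexagonal]
  push_cast
  constructor <;> ring

/-- **`k_n = 1/√6` at the centred hexagonal numbers `n = 3s² + 3s + 1`, `s ≥ 1`** (the "if" half of
"`k_n ≤ 1/√6` with equality iff `n = 1 + 3s + 3s²`"; PROVED from (12), (14)).
[cite: DavoliPiovanoStefanelli2017, p. 631 (remark after Theorem 1.1)] -/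
theorem isoConstant_hexagonal {s : ℕ} (hs : 1 ≤ s) :
    isoConstant (3 * s ^ 2 + 3 * s + 1) = 1 / Real.sqrt 6 := by
  unfold isoConstant
  rw [theta_hexagonal]
  have hs' : (0 : ℝ) < s := by exact_mod_cast hs
  have h6 : (0 : ℝ) < Real.sqrt 6 := Real.sqrt_pos.2 (by norm_num)
  have hnum : (-2 * (((12 * (s : ℤ) + 6 : ℤ)) : ℝ) + 8 * ((3 * s ^ 2 + 3 * s + 1 : ℕ) : ℝ) + 4) =
      (2 * Real.sqrt 6 * s) ^ 2 := by
    push_cast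
    nlinarith [Real.sq_sqrt (show (0 : ℝ) ≤ 6 by norm_num)]
  have hden : ((((12 * (s : ℤ) + 6 : ℤ)) : ℝ) - 6) = 12 * s := by push_cast; ring
  rw [hnum, Real.sqrt_sq (by positivity), hden]
  field_simp
  nlinarith [Real.sq_sqrt (show (0 : ℝ) ≤ 6 by norm_num)]

/-! ## §2 Theorem 1.1 (isoperimetric characterization of the minimizers) -/

/-- **Davoli–Piovano–Stefanelli 2017, Theorem 1.1 (Isoperimetric characterization), NAMED FACT.**  Every
connected configuration `C_n` of `n ≥ 1` points of `𝓛_t` satisfies `√(A(C_n)) ≤ k_n P(C_n)` (13), and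
among connected configurations the minimizers of the EIP are exactly those with equality in (13);
connected configurations have `A ≤ a_n`, `P ≥ p_n` (Proposition 2.3 / p. 641 Step 1), and connected
minimizers attain `A = a_n = −θ_n/2 + 2n + 1`, `P = p_n = θ_n/2 − 3`.
[cite: DavoliPiovanoStefanelli2017, Theorem 1.1 (13)–(14) p. 631; §2.1 Step 1 p. 641] -/
def DavoliPiovanoStefanelli2017_isoperimetric : Prop :=
  (∀ C : Finset Plane, C.Nonempty → (↑C : Set Plane) ⊆ triangularLattice → IsBondConnected C →
      Real.sqrt (area C) ≤ isoConstant C.card * perimeter C ∧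
      (IsTriMinimizer C ↔ Real.sqrt (area C) = isoConstant C.card * perimeter C) ∧
      (area C : ℝ) ≤ maxArea C.card ∧ minPerimeter C.card ≤ perimeter C) ∧
  ∀ C : Finset Plane, C.Nonempty → IsTriMinimizer C → IsBondConnected C →
      (area C : ℝ) = maxArea C.card ∧ perimeter C = minPerimeter C.card

/-! ## §3 Maximal hexagons and the sharp `N^{3/4}` law -/

/-- **A hexagonal configuration of radius `s` at `q`**: `H_s = D_{1+3s+3s²} + q`, the translate by `q`
of the lattice points of the regular hexagon of side `s` about the origin (labels `HarborthSpiral.hexagon s`).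
[cite: DavoliPiovanoStefanelli2017, (54) p. 641; p. 631] -/
def hexConfig (s : ℕ) (q : Plane) : Set Plane :=
  (fun p => p + q) '' (triPoint '' (↑(hexagon s) : Set (ℤ × ℤ)))

/-- **The maximal radius `r_M := max{s : H_s = D_{1+3s+3s²} + q ⊆ M for some q ∈ 𝓛_t}` (55)**
(a maximum over a non-empty bounded set of naturals for non-empty `M ⊆ 𝓛_t`, `exists_hexConfig_subset`).
[cite: DavoliPiovanoStefanelli2017, (54)–(55) p. 641] -/
def maxHexRadius (M : Finset Plane) : ℕ :=
  sSup {s : ℕ | ∃ q ∈ triangularLattice, hexConfig s q ⊆ ↑M}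

/-- The radius-`0` hexagon at a point `q ∈ M ⊆ 𝓛_t` is `{q} ⊆ M`: the set in (55) is non-empty.
[cite: DavoliPiovanoStefanelli2017, (55) p. 641 ("`s ∈ ℕ ∪ {0}`")] -/
theorem exists_hexConfig_subset {M : Finset Plane} (hM : (↑M : Set Plane) ⊆ triangularLattice)
    {q : Plane} (hq : q ∈ M) : ∃ q' ∈ triangularLattice, hexConfig 0 q' ⊆ ↑M := by
  refine ⟨q, hM hq, ?_⟩
  rintro p ⟨y, ⟨k, hk, rfl⟩, rfl⟩
  rw [Literature.Geometry.DiscreteGeometry.HarborthSpiral.hexagon_zero] at hk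
  simp only [Finset.coe_singleton, Set.mem_singleton_iff] at hk
  subst hk
  have h0 : triPoint ((0 : ℤ), (0 : ℤ)) = 0 := map_zero triPoint
  simpa [h0] using hq

/-- **`α_n := √(12n − 3)` (70).** [cite: DavoliPiovanoStefanelli2017, (70) p. 651] -/
def alpha (n : ℕ) : ℝ :=
  Real.sqrt (12 * (n : ℝ) - 3)

/-- **The sharp constant `K_t := 2/3^{1/4}` (19).** [cite: DavoliPiovanoStefanelli2017, (19) p. 632] -/
def sharpConstant : ℝ :=
  2 / (3 : ℝ) ^ (1 / 4 : ℝ)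

/-- **`∫ φ dμ_C` for the empirical measure `μ_C := n⁻¹ Σ_{x∈C} δ_{x/√n}` of an `n`-point set `C`**
(p. 631). [cite: DavoliPiovanoStefanelli2017, p. 631 (definition of `μ_{C_n}`)] -/
def setEmpiricalIntegral (C : Finset Plane) (φ : Plane → ℝ) : ℝ :=
  (C.card : ℝ)⁻¹ * ∑ x ∈ C, φ ((Real.sqrt C.card)⁻¹ • x)

/-- The empirical measure of the point SET of an injective labelled configuration is the re-scaled
empirical measure (1.4) of Au Yeung–Friesecke–Schmidt (`StickyDiscWulffShape.lean`).
[cite: DavoliPiovanoStefanelli2017, p. 631 and (23) p. 634] -/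
theorem setEmpiricalIntegral_image {N : ℕ} {x : Fin N → Plane} (hx : Function.Injective x)
    (φ : Plane → ℝ) :
    setEmpiricalIntegral (univ.image x) φ = empiricalIntegral x φ := by
  unfold setEmpiricalIntegral empiricalIntegral
  rw [card_image_of_injective _ hx, card_univ, Fintype.card_fin, sum_image fun i _ j _ h => hx h]

/-- **Davoli–Piovano–Stefanelli 2017, Proposition 3.7 (lower bound on the maximal radius), NAMED FACT.**
For every minimizer `M_n` (`n ≥ 1`) of the EIP on `𝓛_t`,
`r_{M_n} ≥ ⌈α_n⌉/6 − 2 − (1/6)√(⌈α_n⌉² − α_n² + 75)`, `α_n = √(12n − 3)`.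
[cite: DavoliPiovanoStefanelli2017, Proposition 3.7 (69)–(70) p. 651] -/
def DavoliPiovanoStefanelli2017_maximalRadius : Prop :=
  ∀ M : Finset Plane, M.Nonempty → IsTriMinimizer M →
    (⌈alpha M.card⌉ : ℝ) / 6 - 2 - 1 / 6 * Real.sqrt ((⌈alpha M.card⌉ : ℝ) ^ 2 - alpha M.card ^ 2 + 75)
      ≤ maxHexRadius M

/-- **Davoli–Piovano–Stefanelli 2017, Theorem 1.2 (Convergence to the Wulff shape; (15) and (18) with
the sharp constant `K_t = 2/3^{1/4}`), NAMED FACT.**  For every sequence of minimizers `M_n` (`n`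
points of `𝓛_t`, `n ≥ 1`) there are translations `a_n` such that: `μ_{M_n + a_n} ⇀* (2/√3)χ_W` (weak*,
`C₀` test functions), `W` the regular hexagon `conv{±t₁/√3, ±t₂/√3, ±(t₂ − t₁)/√3}`;
`|M_n ∖ H_{r_{M_n}}| = n − (1 + 3r + 3r²) ≤ K_t n^{3/4} + o(n^{3/4})` (15); and
`‖μ_{M_n + a_n} − (2/√3)χ_W‖_F ≤ 2K_t n^{−1/4} + o(n^{−1/4})` (18).
[cite: DavoliPiovanoStefanelli2017, Theorem 1.2 (15), (18), (19) p. 632; (72) p. 653; (79)–(80) p. 655] -/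
def DavoliPiovanoStefanelli2017_wulffShape : Prop :=
  ∀ M : ℕ → Finset Plane, (∀ n, 1 ≤ n → IsTriMinimizer (M n) ∧ (M n).card = n) →
    ∃ a : ℕ → Plane,
      (∀ g : Plane → ℝ, Continuous g → Tendsto g (cocompact Plane) (𝓝 0) →
        Tendsto (fun n => setEmpiricalIntegral ((M n).image fun x => x + a n) g) atTop
          (𝓝 (2 / Real.sqrt 3 * ∫ y in wulffHexagon, g y))) ∧
      (∀ δ : ℝ, 0 < δ → ∀ᶠ n : ℕ in atTop,
        (n : ℝ) - ((hexagon (maxHexRadius (M n))).card : ℝ) ≤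
          (sharpConstant + δ) * (n : ℝ) ^ (3 / 4 : ℝ)) ∧
      (∀ δ : ℝ, 0 < δ → ∀ᶠ n : ℕ in atTop,
        flatNorm (fun φ => setEmpiricalIntegral ((M n).image fun x => x + a n) φ -
            2 / Real.sqrt 3 * ∫ y in wulffHexagon, φ y) ≤
          (2 * sharpConstant + δ) * (n : ℝ) ^ (-(1 / 4 : ℝ)))

/-- **Davoli–Piovano–Stefanelli 2017, Corollary 1.3 (Hausdorff distance), NAMED FACT.**  There is a
constant `C` (the printed `O(1)`) such that every minimizer `M_n` (`n ≥ 1`) contains a hexagonal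
configuration `H` of maximal radius `r_{M_n}` with `d_H(M_n, H) ≤ 2·3^{1/4} n^{1/4} + C`.
[cite: DavoliPiovanoStefanelli2017, Corollary 1.3 (20) p. 633; proof p. 652] -/
def DavoliPiovanoStefanelli2017_hausdorff : Prop :=
  ∃ C : ℝ, ∀ M : Finset Plane, M.Nonempty → IsTriMinimizer M →
    ∃ q ∈ triangularLattice, hexConfig (maxHexRadius M) q ⊆ ↑M ∧
      hausdorffDist (↑M : Set Plane) (hexConfig (maxHexRadius M) q) ≤
        2 * (3 : ℝ) ^ (1 / 4 : ℝ) * (M.card : ℝ) ^ (1 / 4 : ℝ) + C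

/-- **Davoli–Piovano–Stefanelli 2017, Theorem 1.4 (Sharpness of the estimates), NAMED FACT**, for (15):
along `n_i := 2 + 3i + 3i²` there are minimizers `M_{n_i}` with
`|M_{n_i} ∖ H_{r_{M_{n_i}}}| = K_t n_i^{3/4} + o(n_i^{3/4})`, i.e. the ratio tends to `K_t = 2/3^{1/4}`
((16)–(17) with equality as well in the source; not typed).
[cite: DavoliPiovanoStefanelli2017, Theorem 1.4 p. 634; §4.2 p. 656] -/
def DavoliPiovanoStefanelli2017_sharpness : Prop :=
  ∃ M : ℕ → Finset Plane,
    (∀ i, IsTriMinimizer (M i) ∧ (M i).card = 2 + 3 * i + 3 * i ^ 2) ∧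
    Tendsto (fun i : ℕ =>
        (((2 + 3 * i + 3 * i ^ 2 : ℕ) : ℝ) - ((hexagon (maxHexRadius (M i))).card : ℝ)) /
          ((2 + 3 * i + 3 * i ^ 2 : ℕ) : ℝ) ^ (3 / 4 : ℝ))
      atTop (𝓝 sharpConstant)

/-! ## §4 Theorem 1.1 PROVED: from configurations in the plane to label sets

The bridge `C = triPoint(S)` to the label combinatorics of `TriangularLatticeContactBound.lean` /
`TriangularLatticeAnimals.lean`, and the discharge `DavoliPiovanoStefanelli2017_isoperimetric_holds`. -/

open Theil2006 (triPoint_injective)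
open Literature.Geometry.DiscreteGeometry (harborthNumber adjCount_le_two_mul_harborthNumber
  two_mul_contactPairCount_triPoint exists_injective_contactPairCount_eq_harborthNumber)
open Literature.Geometry.DiscreteGeometry.HarborthSpiral (Adj adjCount nbrs adj_iff_mem_nbrs adj_comm
  normForm_eq_one_iff dist_triPoint_eq_one_iff bondCount triCount upTri downTri mem_upTri mem_downTri
  IsLabelConnected adjCount_eq_two_mul_bondCount triCount_add_card_le_bondCount_add_one
  bondCount_add_one_eq_of_adjCount_eq)


/-- A finite subset of `𝓛_t` is the image of a finite label set. [cite: DavoliPiovanoStefanelli2017, p. 628 (`𝓛_t = {m t₁ + n t₂}`)] -/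
theorem exists_eq_image_triPoint {C : Finset Plane} (hC : (↑C : Set Plane) ⊆ triangularLattice) :
    ∃ S : Finset (ℤ × ℤ), C = S.image triPoint := by
  classical
  refine ⟨C.preimage triPoint (triPoint_injective.injOn), ?_⟩
  rw [Finset.image_preimage]
  ext x
  simp only [mem_filter, iff_self_and]
  intro hx
  exact hC hx

/-- The image of a label set lies in `𝓛_t` and has the same cardinality. [cite: DavoliPiovanoStefanelli2017, p. 628] -/
theorem image_triPoint_subset (S : Finset (ℤ × ℤ)) : (↑(S.image triPoint) : Set Plane) ⊆ triangularLattice := by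
  intro x hx
  obtain ⟨q, -, rfl⟩ := Finset.mem_image.1 (mem_coe.1 hx)
  exact ⟨q, rfl⟩

/-- `|triPoint(S)| = |S|`. [cite: DavoliPiovanoStefanelli2017, p. 628] -/
theorem card_image_triPoint (S : Finset (ℤ × ℤ)) : (S.image triPoint).card = S.card :=
  card_image_of_injective _ triPoint_injective

/-- Every label has exactly six lattice neighbours. [cite: DavoliPiovanoStefanelli2017, (10) p. 630] -/
theorem card_nbrs (q : ℤ × ℤ) : (nbrs q).card = 6 := by
  obtain ⟨a, b⟩ := q
  unfold nbrs
  simp only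
  rw [card_insert_of_notMem, card_insert_of_notMem, card_insert_of_notMem, card_insert_of_notMem,
    card_insert_of_notMem, Finset.card_singleton]
  all_goals simp only [Finset.mem_insert, Finset.mem_singleton, Prod.mk.injEq, not_or]; omega

/-- **`val(x) = 6 − deg(x)`**: the valence (1) of a point of `C = triPoint(S)` is six minus its
number of neighbours in `C`. [cite: DavoliPiovanoStefanelli2017, (10) p. 630] -/
theorem valence_image_triPoint (S : Finset (ℤ × ℤ)) (q : ℤ × ℤ) :
    valence triangularLattice (S.image triPoint) (triPoint q) + (S.filter (Adj q)).card = 6 := by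
  classical
  have hset : {y : Plane | y ∈ triangularLattice ∧ y ∉ S.image triPoint ∧ dist y (triPoint q) = 1} =
      ↑(((nbrs q).filter fun q' => q' ∉ S).image triPoint) := by
    ext y
    simp only [Set.mem_setOf_eq, coe_image, coe_filter, Set.mem_image]
    constructor
    · rintro ⟨⟨q', rfl⟩, hy, hd⟩
      refine ⟨q', ⟨?_, fun hq' => hy (mem_image_of_mem _ hq')⟩, rfl⟩
      exact (adj_iff_mem_nbrs q q').1 ((adj_comm _ _).1 ((dist_triPoint_eq_one_iff q' q).1 hd))
    · rintro ⟨q', ⟨hn, hnS⟩, rfl⟩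
      refine ⟨⟨q', rfl⟩, fun h => hnS ?_,
        (dist_triPoint_eq_one_iff q' q).2 ((adj_comm _ _).1 ((adj_iff_mem_nbrs q q').2 hn))⟩
      obtain ⟨q'', hq'', he⟩ := Finset.mem_image.1 h
      rwa [← triPoint_injective he]
  unfold valence
  rw [hset, Set.ncard_coe_finset, card_image_of_injective _ triPoint_injective]
  have h2 : (nbrs q).filter (fun q' => q' ∈ S) = S.filter (Adj q) := by
    ext q'
    simp only [mem_filter, adj_iff_mem_nbrs]
    tauto
  have h1 := Finset.card_filter_add_card_filter_not (s := nbrs q) (fun q' => q' ∈ S)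
  rw [h2, card_nbrs] at h1
  omega

/-- **`|Θ(C)| = 6n − 2b`** for `C = triPoint(S)` with `b` adjacent pairs. [cite: DavoliPiovanoStefanelli2017, (10) p. 630] -/
theorem edgeBoundaryCard_image_triPoint (S : Finset (ℤ × ℤ)) :
    edgeBoundaryCard (S.image triPoint) + adjCount S = 6 * S.card := by
  unfold edgeBoundaryCard adjCount
  rw [sum_image fun a _ b _ h => triPoint_injective h, ← sum_add_distrib]
  simp_rw [valence_image_triPoint]
  rw [sum_const, smul_eq_mul, mul_comm]

/-! ### Unit triangles: every triple of pairwise adjacent labels is an up or a down triangle -/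

/-- An up triangle has three vertices. [cite: DavoliPiovanoStefanelli2017, (25) p. 635] -/
private theorem card_upSet (u : ℤ × ℤ) : ({u, (u.1 + 1, u.2), (u.1, u.2 + 1)} : Finset (ℤ × ℤ)).card = 3 := by
  rw [card_eq_three]
  refine ⟨u, (u.1 + 1, u.2), (u.1, u.2 + 1), ?_, ?_, ?_, rfl⟩ <;>
    simp only [ne_eq, Prod.ext_iff, not_and] <;> omega

/-- A down triangle has three vertices. [cite: DavoliPiovanoStefanelli2017, (25) p. 635] -/
private theorem card_downSet (v : ℤ × ℤ) : ({v, (v.1 - 1, v.2 + 1), (v.1, v.2 + 1)} : Finset (ℤ × ℤ)).card = 3 := by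
  rw [card_eq_three]
  refine ⟨v, (v.1 - 1, v.2 + 1), (v.1, v.2 + 1), ?_, ?_, ?_, rfl⟩ <;>
    simp only [ne_eq, Prod.ext_iff, not_and] <;> omega

/-- Lattice adjacency in coordinates. [cite: Theil2006, §2.3 Remark 2.5] -/
private theorem adj_iff_coords (p q : ℤ × ℤ) : Adj p q ↔
    (q.1 - p.1 = 1 ∧ q.2 - p.2 = 0) ∨ (q.1 - p.1 = -1 ∧ q.2 - p.2 = 0) ∨ (q.1 - p.1 = 0 ∧ q.2 - p.2 = 1) ∨
      (q.1 - p.1 = 0 ∧ q.2 - p.2 = -1) ∨ (q.1 - p.1 = 1 ∧ q.2 - p.2 = -1) ∨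
      (q.1 - p.1 = -1 ∧ q.2 - p.2 = 1) := by
  obtain ⟨p1, p2⟩ := p
  obtain ⟨q1, q2⟩ := q
  rw [Adj, Prod.mk_sub_mk, normForm_eq_one_iff]

/-- The vertices of an up triangle are pairwise adjacent. [cite: DavoliPiovanoStefanelli2017, (25) p. 635] -/
private theorem pairwise_adj_upSet (u : ℤ × ℤ) :
    ∀ a ∈ ({u, (u.1 + 1, u.2), (u.1, u.2 + 1)} : Finset (ℤ × ℤ)), ∀ b ∈ ({u, (u.1 + 1, u.2), (u.1, u.2 + 1)} : Finset (ℤ × ℤ)), a ≠ b → Adj a b := by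
  intro a ha b hb hab
  simp only [Finset.mem_insert, Finset.mem_singleton] at ha hb
  rw [adj_iff_coords]
  rw [ne_eq, Prod.ext_iff] at hab
  rcases ha with rfl | rfl | rfl <;> rcases hb with rfl | rfl | rfl <;>
    simp only [and_true, and_self, not_true_eq_false] at hab ⊢ <;> omega

/-- The vertices of a down triangle are pairwise adjacent. [cite: DavoliPiovanoStefanelli2017, (25) p. 635] -/
private theorem pairwise_adj_downSet (v : ℤ × ℤ) :
    ∀ a ∈ ({v, (v.1 - 1, v.2 + 1), (v.1, v.2 + 1)} : Finset (ℤ × ℤ)), ∀ b ∈ ({v, (v.1 - 1, v.2 + 1), (v.1, v.2 + 1)} : Finset (ℤ × ℤ)), a ≠ b → Adj a b := by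
  intro a ha b hb hab
  simp only [Finset.mem_insert, Finset.mem_singleton] at ha hb
  rw [adj_iff_coords]
  rw [ne_eq, Prod.ext_iff] at hab
  rcases ha with rfl | rfl | rfl <;> rcases hb with rfl | rfl | rfl <;>
    simp only [and_true, and_self, not_true_eq_false] at hab ⊢ <;> omega

/-- **Classification of unit triangles**: three pairwise adjacent labels contain an anchor `u`
with `u + (1,0), u + (0,1)` among them (up triangle) or an anchor `v` with `v + (-1,1), v + (0,1)`
among them (down triangle). [cite: DavoliPiovanoStefanelli2017, (25) p. 635] -/
theorem exists_anchor {x y z : ℤ × ℤ} (hxy : Adj x y) (hxz : Adj x z) (hyz : Adj y z) :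
    (∃ u ∈ ({x, y, z} : Finset (ℤ × ℤ)), (u.1 + 1, u.2) ∈ ({x, y, z} : Finset (ℤ × ℤ)) ∧
        (u.1, u.2 + 1) ∈ ({x, y, z} : Finset (ℤ × ℤ))) ∨
      ∃ v ∈ ({x, y, z} : Finset (ℤ × ℤ)), (v.1 - 1, v.2 + 1) ∈ ({x, y, z} : Finset (ℤ × ℤ)) ∧
        (v.1, v.2 + 1) ∈ ({x, y, z} : Finset (ℤ × ℤ)) := by
  obtain ⟨x1, x2⟩ := x
  obtain ⟨y1, y2⟩ := y
  obtain ⟨z1, z2⟩ := z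
  rw [adj_iff_coords] at hxy hxz hyz
  simp only at hxy hxz hyz
  simp only [Finset.mem_insert, Finset.mem_singleton, exists_eq_or_imp, exists_eq_left, Prod.mk.injEq,
    true_and, and_true]
  rcases hxy with ⟨h1, h2⟩ | ⟨h1, h2⟩ | ⟨h1, h2⟩ | ⟨h1, h2⟩ | ⟨h1, h2⟩ | ⟨h1, h2⟩ <;>
  rcases hxz with ⟨h3, h4⟩ | ⟨h3, h4⟩ | ⟨h3, h4⟩ | ⟨h3, h4⟩ | ⟨h3, h4⟩ | ⟨h3, h4⟩ <;>
  first
    | (exfalso; omega)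
    | (left; left; constructor <;> omega)
    | (left; right; left; constructor <;> omega)
    | (left; right; right; constructor <;> omega)
    | (right; left; constructor <;> omega)
    | (right; right; left; constructor <;> omega)
    | (right; right; right; constructor <;> omega)

/-- **`A(C)` counts the up and down triangles**: `area (triPoint(S)) = triCount S`.
[cite: DavoliPiovanoStefanelli2017, (25) p. 635] -/
theorem area_image_triPoint (S : Finset (ℤ × ℤ)) : area (S.image triPoint) = triCount S := by
  -- transfer to label triples
  let e : ℤ × ℤ ↪ Plane := ⟨triPoint, triPoint_injective⟩
  have himage : S.image triPoint = S.map e := (map_eq_image e S).symm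
  set F := (S.powersetCard 3).filter fun τ => ∀ a ∈ τ, ∀ b ∈ τ, a ≠ b → Adj a b with hF
  have hA : area (S.image triPoint) = F.card := by
    unfold area
    rw [himage, powersetCard_map, filter_map, card_map]
    congr 1
    refine filter_congr fun τ _ => ?_
    simp only [Function.comp, RelEmbedding.coe_toEmbedding, mapEmbedding_apply, forall_mem_map]
    refine forall₄_congr fun a _ b _ => ?_
    rw [e.injective.ne_iff, show e a = triPoint a from rfl, show e b = triPoint b from rfl,
      dist_triPoint_eq_one_iff]
  rw [hA]
  -- `F` is the disjoint union of the up and the down triangle sets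
  have hup : ∀ u ∈ upTri S, ({u, (u.1 + 1, u.2), (u.1, u.2 + 1)} : Finset (ℤ × ℤ)) ∈ F := by
    intro u hu
    rw [mem_upTri] at hu
    rw [hF, mem_filter, mem_powersetCard]
    refine ⟨⟨?_, card_upSet u⟩, pairwise_adj_upSet u⟩
    intro a ha
    simp only [Finset.mem_insert, Finset.mem_singleton] at ha
    rcases ha with rfl | rfl | rfl
    · exact hu.1
    · exact hu.2.1
    · exact hu.2.2
  have hdown : ∀ v ∈ downTri S, ({v, (v.1 - 1, v.2 + 1), (v.1, v.2 + 1)} : Finset (ℤ × ℤ)) ∈ F := by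
    intro v hv
    rw [mem_downTri] at hv
    rw [hF, mem_filter, mem_powersetCard]
    refine ⟨⟨?_, card_downSet v⟩, pairwise_adj_downSet v⟩
    intro a ha
    simp only [Finset.mem_insert, Finset.mem_singleton] at ha
    rcases ha with rfl | rfl | rfl
    · exact hv.1
    · exact hv.2.1
    · exact hv.2.2
  have hcover : ∀ τ ∈ F, (∃ u ∈ upTri S, ({u, (u.1 + 1, u.2), (u.1, u.2 + 1)} : Finset (ℤ × ℤ)) = τ) ∨
      ∃ v ∈ downTri S, ({v, (v.1 - 1, v.2 + 1), (v.1, v.2 + 1)} : Finset (ℤ × ℤ)) = τ := by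
    intro τ hτ
    rw [hF, mem_filter, mem_powersetCard] at hτ
    obtain ⟨⟨hτS, hτ3⟩, hadj⟩ := hτ
    obtain ⟨x, y, z, hxy, hxz, hyz, rfl⟩ := card_eq_three.1 hτ3
    have ax := hadj x (by simp) y (by simp) hxy
    have bx := hadj x (by simp) z (by simp) hxz
    have cx := hadj y (by simp) z (by simp) hyz
    rcases exists_anchor ax bx cx with ⟨u, hu, hu1, hu2⟩ | ⟨v, hv, hv1, hv2⟩
    · left
      have hsub : ({u, (u.1 + 1, u.2), (u.1, u.2 + 1)} : Finset (ℤ × ℤ)) ⊆ {x, y, z} := by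
        intro a ha
        simp only [Finset.mem_insert, Finset.mem_singleton] at ha
        rcases ha with rfl | rfl | rfl
        · exact hu
        · exact hu1
        · exact hu2
      refine ⟨u, mem_upTri.2 ⟨hτS hu, hτS hu1, hτS hu2⟩, ?_⟩
      exact eq_of_subset_of_card_le hsub (by rw [card_upSet, hτ3])
    · right
      have hsub : ({v, (v.1 - 1, v.2 + 1), (v.1, v.2 + 1)} : Finset (ℤ × ℤ)) ⊆ {x, y, z} := by
        intro a ha
        simp only [Finset.mem_insert, Finset.mem_singleton] at ha
        rcases ha with rfl | rfl | rfl
        · exact hv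
        · exact hv1
        · exact hv2
      refine ⟨v, mem_downTri.2 ⟨hτS hv, hτS hv1, hτS hv2⟩, ?_⟩
      exact eq_of_subset_of_card_le hsub (by rw [card_downSet, hτ3])
  have hFeq : F = (upTri S).image (fun u : ℤ × ℤ => ({u, (u.1 + 1, u.2), (u.1, u.2 + 1)} : Finset (ℤ × ℤ))) ∪
      (downTri S).image (fun v : ℤ × ℤ => ({v, (v.1 - 1, v.2 + 1), (v.1, v.2 + 1)} : Finset (ℤ × ℤ))) := by
    ext τ
    rw [Finset.mem_union, Finset.mem_image, Finset.mem_image]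
    constructor
    · exact hcover τ
    · rintro (⟨u, hu, rfl⟩ | ⟨v, hv, rfl⟩)
      · exact hup u hu
      · exact hdown v hv
  have hinjU : Set.InjOn (fun u : ℤ × ℤ => ({u, (u.1 + 1, u.2), (u.1, u.2 + 1)} : Finset (ℤ × ℤ))) ↑(upTri S) := by
    rintro ⟨a, b⟩ - ⟨c, d⟩ - h
    simp only at h
    have h1 : ((a, b) : ℤ × ℤ) ∈ ({(c, d), (c + 1, d), (c, d + 1)} : Finset (ℤ × ℤ)) := by
      rw [← h]; simp
    have h2 : ((c, d) : ℤ × ℤ) ∈ ({(a, b), (a + 1, b), (a, b + 1)} : Finset (ℤ × ℤ)) := by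
      rw [h]; simp
    simp only [Finset.mem_insert, Finset.mem_singleton, Prod.mk.injEq] at h1 h2
    ext <;> simp only <;> omega
  have hinjD : Set.InjOn (fun v : ℤ × ℤ => ({v, (v.1 - 1, v.2 + 1), (v.1, v.2 + 1)} : Finset (ℤ × ℤ))) ↑(downTri S) := by
    rintro ⟨a, b⟩ - ⟨c, d⟩ - h
    simp only at h
    have h1 : ((a, b) : ℤ × ℤ) ∈ ({(c, d), (c - 1, d + 1), (c, d + 1)} : Finset (ℤ × ℤ)) := by
      rw [← h]; simp
    have h2 : ((c, d) : ℤ × ℤ) ∈ ({(a, b), (a - 1, b + 1), (a, b + 1)} : Finset (ℤ × ℤ)) := by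
      rw [h]; simp
    simp only [Finset.mem_insert, Finset.mem_singleton, Prod.mk.injEq] at h1 h2
    ext <;> simp only <;> omega
  have hdisj : Disjoint ((upTri S).image (fun u : ℤ × ℤ => ({u, (u.1 + 1, u.2), (u.1, u.2 + 1)} : Finset (ℤ × ℤ))))
      ((downTri S).image (fun v : ℤ × ℤ => ({v, (v.1 - 1, v.2 + 1), (v.1, v.2 + 1)} : Finset (ℤ × ℤ)))) := by
    rw [Finset.disjoint_left]
    rintro τ h1 h2
    obtain ⟨⟨a, b⟩, -, rfl⟩ := Finset.mem_image.1 h1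
    obtain ⟨⟨c, d⟩, -, h⟩ := Finset.mem_image.1 h2
    simp only at h
    have e1 : ((c, d) : ℤ × ℤ) ∈ ({(a, b), (a + 1, b), (a, b + 1)} : Finset (ℤ × ℤ)) := by
      rw [← h]; simp
    have e2 : ((c - 1, d + 1) : ℤ × ℤ) ∈ ({(a, b), (a + 1, b), (a, b + 1)} : Finset (ℤ × ℤ)) := by
      rw [← h]; simp
    have e3 : ((c, d + 1) : ℤ × ℤ) ∈ ({(a, b), (a + 1, b), (a, b + 1)} : Finset (ℤ × ℤ)) := by
      rw [← h]; simp
    simp only [Finset.mem_insert, Finset.mem_singleton, Prod.mk.injEq] at e1 e2 e3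
    omega
  rw [hFeq, card_union_of_disjoint hdisj, card_image_of_injOn hinjU, card_image_of_injOn hinjD]
  rfl

/-! ### Connectedness and minimality transfer -/

/-- Bond-connectedness of `triPoint(S)` is bond-connectedness of the label set `S`.
[cite: DavoliPiovanoStefanelli2017, p. 630 (connected configurations)] -/
theorem isLabelConnected_of_isBondConnected {S : Finset (ℤ × ℤ)}
    (h : IsBondConnected (S.image triPoint)) : IsLabelConnected S := by
  intro p hp q hq
  have hpq := h (triPoint p) (mem_image_of_mem _ hp) (triPoint q) (mem_image_of_mem _ hq)
  -- pull the chain back along the injective `triPoint`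
  suffices ∀ y, Relation.ReflTransGen
      (fun a b => a ∈ S.image triPoint ∧ b ∈ S.image triPoint ∧ dist a b = 1) (triPoint p) y →
      ∀ q', y = triPoint q' → Relation.ReflTransGen (fun a b => a ∈ S ∧ b ∈ S ∧ Adj a b) p q' from
    this _ hpq q rfl
  intro y hy
  induction hy with
  | refl =>
    intro q' hq'
    rw [triPoint_injective hq']
  | tail hab hbc ih =>
    rename_i b c
    intro q' hq'
    obtain ⟨hbS, hcS, hd⟩ := hbc
    obtain ⟨b', hb', rfl⟩ := Finset.mem_image.1 hbS
    subst hq'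
    have hq'S : q' ∈ S := by
      obtain ⟨c', hc', he⟩ := Finset.mem_image.1 hcS
      rwa [← triPoint_injective he]
    exact (ih b' rfl).tail ⟨hb', hq'S, (dist_triPoint_eq_one_iff b' q').1 hd⟩

/-- `(½Σval)(triPoint S) = ½ (6n − adjCount S)`. [cite: DavoliPiovanoStefanelli2017, (10) p. 630] -/
theorem triangularExcess_image_triPoint (S : Finset (ℤ × ℤ)) :
    triangularExcess (S.image triPoint) = (1 / 2) * (6 * (S.card : ℝ) - (adjCount S : ℝ)) := by
  have h1 := edgeBoundaryCard_eq (S.image triPoint)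
  have h2 := edgeBoundaryCard_image_triPoint S
  have h3 : ((edgeBoundaryCard (S.image triPoint) : ℕ) : ℝ) + (adjCount S : ℝ) = 6 * (S.card : ℝ) := by
    exact_mod_cast h2
  linarith

/-- **EIP minimizers are the contact maximizers**: `triPoint(S)` minimizes the edge perimeter
among `n`-point subsets of `𝓛_t` iff `S` attains the on-lattice Harborth bound
`[3n − √(12n−3)]` (`(11)–(12)`, Heitmann–Radin / Harborth). [cite: DavoliPiovanoStefanelli2017, (11)–(12) p. 630] -/
theorem isTriMinimizer_image_triPoint_iff (S : Finset (ℤ × ℤ)) :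
    IsTriMinimizer (S.image triPoint) ↔ 2 * harborthNumber S.card ≤ (adjCount S : ℤ) := by
  classical
  constructor
  · rintro ⟨-, hmin⟩
    -- compare with an extremal configuration (Harborth's spiral)
    obtain ⟨c, hc, hcH⟩ := exists_injective_contactPairCount_eq_harborthNumber S.card
    have h2 := two_mul_contactPairCount_triPoint c hc
    set S' : Finset (ℤ × ℤ) := univ.image c with hS'
    have hS'card : S'.card = S.card := by
      rw [hS', card_image_of_injective _ hc, card_univ, Fintype.card_fin]
    have hle := hmin (S'.image triPoint) (image_triPoint_subset S')
      (by rw [card_image_triPoint, card_image_triPoint, hS'card])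
    rw [add_zero, triangularExcess_image_triPoint, triangularExcess_image_triPoint, hS'card] at hle
    have h3 : (adjCount S' : ℤ) = 2 * harborthNumber S.card := by
      rw [← hcH]; exact_mod_cast h2.symm
    have h4 : (adjCount S' : ℝ) ≤ (adjCount S : ℝ) := by linarith
    have h5 : (adjCount S' : ℤ) ≤ (adjCount S : ℤ) := by exact_mod_cast h4
    linarith
  · intro hmax
    refine ⟨image_triPoint_subset S, fun Y hY hYcard => ?_⟩
    obtain ⟨S', rfl⟩ := exists_eq_image_triPoint hY
    rw [card_image_triPoint, card_image_triPoint] at hYcard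
    rw [add_zero, triangularExcess_image_triPoint, triangularExcess_image_triPoint, hYcard]
    have h1 := adjCount_le_two_mul_harborthNumber S'
    rw [hYcard] at h1
    have h2 : (adjCount S' : ℤ) ≤ adjCount S := h1.trans hmax
    have h3 : (adjCount S' : ℝ) ≤ adjCount S := by exact_mod_cast h2
    linarith

/-! ### Arithmetic of `θ_n`, `a_n`, `p_n`, `k_n` -/

/-- `θ_n = 6n − 2[3n − √(12n−3)]` ((11)–(12): `θ_n = 6n + 2 e_n`, `e_n = −[3n − √(12n−3)]`).
[cite: DavoliPiovanoStefanelli2017, (11)–(12) p. 630] -/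
theorem theta_eq (n : ℕ) : (theta n : ℝ) = 6 * n - 2 * (harborthNumber n : ℝ) := by
  have h := Literature.Geometry.DiscreteGeometry.Harborth.harborthNumber_eq_sub_ceil n
  unfold theta
  rw [h]
  push_cast
  ring

/-- `p_n = θ_n/2 − 3 > 0` for `n ≥ 2` (`√(12n − 3) > 3`). [cite: DavoliPiovanoStefanelli2017, (12), (14) p. 630–631] -/
theorem minPerimeter_pos {n : ℕ} (hn : 2 ≤ n) : 0 < minPerimeter n := by
  unfold minPerimeter theta
  have h3 : (3 : ℤ) < ⌈Real.sqrt (12 * (n : ℝ) - 3)⌉ := by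
    rw [Int.lt_ceil]
    push_cast
    rw [Real.lt_sqrt (by norm_num)]
    have : (2 : ℝ) ≤ n := by exact_mod_cast hn
    nlinarith
  have h4 : (4 : ℤ) ≤ ⌈Real.sqrt (12 * (n : ℝ) - 3)⌉ := h3
  have h5 : (4 : ℝ) ≤ (⌈Real.sqrt (12 * (n : ℝ) - 3)⌉ : ℝ) := by exact_mod_cast h4
  push_cast
  linarith

/-- `k_n = √(a_n) / p_n` (as `√(4a_n)/(2p_n)`), for `n ≥ 2` and `a_n ≥ 0`.
[cite: DavoliPiovanoStefanelli2017, (14) p. 631] -/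
theorem isoConstant_eq {n : ℕ} (hn : 2 ≤ n) :
    isoConstant n = Real.sqrt (maxArea n) / minPerimeter n := by
  have hp := minPerimeter_pos hn
  unfold isoConstant
  unfold minPerimeter at hp ⊢
  unfold maxArea
  have e1 : (-2 * (theta n : ℝ) + 8 * n + 4) = 2 ^ 2 * (-(theta n : ℝ) / 2 + 2 * n + 1) := by ring
  rw [e1, Real.sqrt_mul (by norm_num), Real.sqrt_sq (by norm_num)]
  have e2 : ((theta n : ℝ) - 6) = 2 * ((theta n : ℝ) / 2 - 3) := by ring
  rw [e2, mul_div_mul_left _ _ (by norm_num : (2 : ℝ) ≠ 0)]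

/-! ### Theorem 1.1 -/

/-- **Davoli–Piovano–Stefanelli 2017, Theorem 1.1 (Isoperimetric characterization) — PROVED**: the
named fact `DavoliPiovanoStefanelli2017_isoperimetric` holds.  For a connected configuration
`C = triPoint(S)` of `n` points with `b` bonds and `A` unit triangles: `|Θ| = 6n − 2b`, `P = 2b − 3A`,
`b ≤ [3n − √(12n−3)] =: H` (Harborth, on-lattice), `A + n ≤ b + 1` (Euler), whence
`A ≤ H − n + 1 = a_n`, `P ≥ 3n − 3 − H = p_n` and (13) with `k_n = √(a_n)/p_n` (`n ≥ 2`; `n = 1`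
is `0 ≤ 0`); equality in (13) forces `A = a_n`, hence `b ≥ n − 1 + A = H`, i.e. `C` minimizes;
conversely a connected minimizer has `b = H` and no holes (`b + 1 = A + n`), so `A = a_n`, `P = p_n`.
[cite: DavoliPiovanoStefanelli2017, Theorem 1.1 (13)–(14) p. 631; §2.1 p. 640–641] -/
theorem DavoliPiovanoStefanelli2017_isoperimetric_holds : DavoliPiovanoStefanelli2017_isoperimetric := by
  classical
  -- the common bookkeeping for a connected configuration
  have main : ∀ C : Finset Plane, C.Nonempty → (↑C : Set Plane) ⊆ triangularLattice →
      IsBondConnected C → ∃ S : Finset (ℤ × ℤ), C = S.image triPoint ∧ S.Nonempty ∧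
        IsLabelConnected S ∧ C.card = S.card ∧
        (area C : ℝ) = triCount S ∧
        perimeter C = 2 * (bondCount S : ℝ) - 3 * (triCount S : ℝ) ∧
        (triCount S : ℝ) + S.card ≤ bondCount S + 1 ∧
        (bondCount S : ℝ) ≤ harborthNumber S.card ∧
        maxArea S.card = (harborthNumber S.card : ℝ) - S.card + 1 ∧
        minPerimeter S.card = 3 * (S.card : ℝ) - harborthNumber S.card - 3 := by
    intro C hCne hC hconn
    obtain ⟨S, rfl⟩ := exists_eq_image_triPoint hC
    have hSne : S.Nonempty := by
      obtain ⟨x, hx⟩ := hCne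
      obtain ⟨q, hq, -⟩ := Finset.mem_image.1 hx
      exact ⟨q, hq⟩
    have hlc := isLabelConnected_of_isBondConnected hconn
    have hcard := card_image_triPoint S
    have hA := area_image_triPoint S
    have hΘ := edgeBoundaryCard_image_triPoint S
    have hadj := adjCount_eq_two_mul_bondCount S
    have hEu' := triCount_add_card_le_bondCount_add_one hSne hlc
    have hH := adjCount_le_two_mul_harborthNumber S
    refine ⟨S, rfl, hSne, hlc, hcard, by rw [hA], ?_, by exact_mod_cast hEu', ?_, ?_, ?_⟩
    · unfold perimeter
      rw [hcard, hA]
      have : ((edgeBoundaryCard (S.image triPoint) : ℕ) : ℝ) = 6 * S.card - 2 * bondCount S := by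
        have := hΘ; rw [hadj] at this
        have h' : ((edgeBoundaryCard (S.image triPoint) : ℕ) : ℝ) + 2 * (bondCount S : ℝ) = 6 * S.card := by
          exact_mod_cast this
        linarith
      rw [this]; ring
    · rw [hadj] at hH
      push_cast at hH
      have : ((bondCount S : ℕ) : ℤ) ≤ harborthNumber S.card := by linarith
      exact_mod_cast this
    · unfold maxArea; rw [theta_eq]; ring
    · unfold minPerimeter; rw [theta_eq]; ring
  refine ⟨fun C hCne hC hconn => ?_, fun C hCne hmin hconn => ?_⟩
  · obtain ⟨S, rfl, hSne, hlc, hcard, hA, hP, hEu', hH, ha, hp⟩ := main C hCne hC hconn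
    rw [hcard]
    have hn1 : (1 : ℝ) ≤ S.card := by exact_mod_cast hSne.card_pos
    -- (iii)
    have hAle : (area (S.image triPoint) : ℝ) ≤ maxArea S.card := by rw [hA, ha]; linarith
    have hPge : minPerimeter S.card ≤ perimeter (S.image triPoint) := by rw [hP, hp]; linarith
    have hA0 : (0 : ℝ) ≤ area (S.image triPoint) := Nat.cast_nonneg _
    have hamax0 : 0 ≤ maxArea S.card := hA0.trans hAle
    -- the minimizer criterion in label form
    have hmin_iff : IsTriMinimizer (S.image triPoint) ↔ (harborthNumber S.card : ℝ) ≤ bondCount S := by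
      rw [isTriMinimizer_image_triPoint_iff, adjCount_eq_two_mul_bondCount]
      push_cast
      constructor
      · intro h
        have : (harborthNumber S.card : ℤ) ≤ (bondCount S : ℕ) := by linarith
        exact_mod_cast this
      · intro h
        have : (harborthNumber S.card : ℤ) ≤ (bondCount S : ℕ) := by exact_mod_cast h
        linarith
    rcases Nat.lt_or_ge S.card 2 with hlt | h2
    · -- `n = 1`: one point, `A = 0`, `θ_1 = 6`, `k_1 = 0`, and every singleton is a minimizer
      have hn : S.card = 1 := by have := hSne.card_pos; omega
      have hH1 : harborthNumber S.card = 0 := by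
        rw [hn]; simpa using Literature.Geometry.DiscreteGeometry.harborthNumber_hexagonal 0
      have hθ : theta S.card = 6 := by rw [hn]; simpa using theta_hexagonal 0
      have hk : isoConstant S.card = 0 := by
        unfold isoConstant; rw [hθ]; norm_num
      have hAz : (area (S.image triPoint) : ℝ) = 0 := by
        apply le_antisymm _ hA0
        rw [ha, hH1, hn] at hAle; push_cast at hAle; linarith
      have hb0 : (harborthNumber S.card : ℝ) ≤ bondCount S := by
        rw [hH1]; push_cast; exact Nat.cast_nonneg _
      refine ⟨?_, ?_, hAle, hPge⟩
      · rw [hAz, Real.sqrt_zero, hk, zero_mul]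
      · rw [hAz, Real.sqrt_zero, hk, zero_mul]
        exact ⟨fun _ => rfl, fun _ => hmin_iff.2 hb0⟩
    · -- `n ≥ 2`
      have hp0 := minPerimeter_pos h2
      have hk := isoConstant_eq h2
      have hP0 : 0 < perimeter (S.image triPoint) := lt_of_lt_of_le hp0 hPge
      have hk0 : 0 ≤ isoConstant S.card := by rw [hk]; positivity
      -- (13)
      have h13 : Real.sqrt (area (S.image triPoint)) ≤ isoConstant S.card * perimeter (S.image triPoint) := by
        rw [hk, div_mul_eq_mul_div, le_div_iff₀ hp0]
        calc Real.sqrt (area (S.image triPoint)) * minPerimeter S.card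
            ≤ Real.sqrt (maxArea S.card) * minPerimeter S.card :=
              mul_le_mul_of_nonneg_right (Real.sqrt_le_sqrt hAle) hp0.le
          _ ≤ Real.sqrt (maxArea S.card) * perimeter (S.image triPoint) :=
              mul_le_mul_of_nonneg_left hPge (Real.sqrt_nonneg _)
      refine ⟨h13, ⟨fun hm => ?_, fun heq => ?_⟩, hAle, hPge⟩
      · -- minimizer ⇒ equality: `A = a_n`, `P = p_n`
        have hb : (harborthNumber S.card : ℝ) ≤ bondCount S := hmin_iff.1 hm
        have hbeq : (bondCount S : ℝ) = harborthNumber S.card := le_antisymm hH hb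
        have hNH' := bondCount_add_one_eq_of_adjCount_eq hSne hlc ((isTriMinimizer_image_triPoint_iff S).1 hm)
        have hNHr : (bondCount S : ℝ) + 1 = triCount S + S.card := by exact_mod_cast hNH'
        have hAeq : (area (S.image triPoint) : ℝ) = maxArea S.card := by rw [hA, ha]; linarith
        have hPeq : perimeter (S.image triPoint) = minPerimeter S.card := by rw [hP, hp]; linarith
        rw [hAeq, hPeq, hk, div_mul_cancel₀ _ hp0.ne']
      · -- equality ⇒ minimizer: `A ≥ a_n`, hence `b ≥ n − 1 + A = H`
        have hge : Real.sqrt (maxArea S.card) ≤ Real.sqrt (area (S.image triPoint)) := by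
          rw [heq, hk, div_mul_eq_mul_div, le_div_iff₀ hp0]
          exact mul_le_mul_of_nonneg_left hPge (Real.sqrt_nonneg _)
        rw [Real.sqrt_le_sqrt_iff hA0] at hge
        apply hmin_iff.2
        rw [hA, ha] at hge
        linarith
  · -- Part 2: connected minimizers attain `A = a_n`, `P = p_n`
    have hC : (↑C : Set Plane) ⊆ triangularLattice := hmin.1
    obtain ⟨S, rfl, hSne, hlc, hcard, hA, hP, hEu', hH, ha, hp⟩ := main C hCne hC hconn
    rw [hcard]
    have hmax := (isTriMinimizer_image_triPoint_iff S).1 hmin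
    have hNH' := bondCount_add_one_eq_of_adjCount_eq hSne hlc hmax
    have hNHr : (bondCount S : ℝ) + 1 = triCount S + S.card := by exact_mod_cast hNH'
    have hb : (harborthNumber S.card : ℝ) ≤ bondCount S := by
      rw [adjCount_eq_two_mul_bondCount] at hmax; push_cast at hmax
      have : (harborthNumber S.card : ℤ) ≤ (bondCount S : ℕ) := by linarith
      exact_mod_cast this
    have hbeq : (bondCount S : ℝ) = harborthNumber S.card := le_antisymm hH hb
    constructor
    · rw [hA, ha]; linarith
    · rw [hP, hp]; linarith

end Literature.MathematicalPhysics.StatisticalMechanics.DavoliPiovanoStefanelli2017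

end
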